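import Summits.ResolutionOfSingularities.ResolutionOfSingularities.Theorems.PurelyInseparableDim4PhiLineStepLaws
import Summits.ResolutionOfSingularities.ResolutionOfSingularities.Theorems.PurelyInseparableDim4PhiLineUnitRescale
import HarnessLib

/-!
# (R3b) The LOSE-h law, TRANSLATED VARIANT: the critical letter translated away in a chart `j ≠ h`
# (cell `res-dim4-pi`, K2(p) lane, slice C `(5,3)`, Φ = β_h line; residue (R3) of res-dim4-idea-1 g7's list)

[OURS · counted 0 · cell `res-dim4-pi` · K2(p) lane holder res-dim4-p-12 g4, HOLDER WORD g4-2 (2026-08-29 05:53Z) «p-2 takes (R3) LOSE LAW,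
TRANSLATED VARIANT»; seat res-dim4-p-2 g5 over res-dim4-p-11 g4's (K-Φ2) I–IV (`…PhiLineChartHom`, `…StepResidual`, `…LinearFrame`,
`…StepLaws`), (K-Φ3) V `…CleaningBlind`, the Literature laws `WeightedOrder.pts_colon_nonempty / alphaS_colon_add / betaS_colon_le`
(`…PointBlowupPolygonLawsIndexed`) and this seat's (R3a) `…PhiLineUnitRescale`.]  Nothing here proves K2(5), the β_h line or resolution
of singularities in dimension ≥ 4 / characteristic `p` — NOT proved.  AI kernel work, weaker than expert review.

res-dim4-p-11 g4's `betaS_step_le_of_lose` reads a LOSE-h step in the chart of the critical letter `h` (`b_h = 0`).  `Step0` also admits,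
at a point with `b_h ≠ 0`, a chart `j ≠ h`: then `h` is translated away, `φ(x_h) = x_j·(x_h + b_h)` = NEWBORN × UNIT, the newborn `x_j`
(weight `|r| + d − p`) is the new critical letter, and the point map `(a₁, a₂) ↦ (a₁ + a₂ − 1, a₂)` is the same (a `Q`-step of the B∞
automaton hits `h` EITHER by charting OR by translating it, holder's `ResCone.bInf_pattern`).  **`betaS_step_le_of_lose_translated`**: IV's
statement with `(hjh : j ≠ h) (hbj : b j = 0) (hbh : b h ≠ 0)`, chart `j`, arrival pivot `u₁′ = e_j`; conclusion character-identical
(`pts ≠ ∅`, `αs′ + d! = δs`, `βs′ ≤ βs`).  Proof: the abstract `u1`-chart laws applied to the UNIT-RESCALED arrival frame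
`c″ = E • c′` (`E(u₁) = (x_h + b_h)/1`, `E = its inverse` elsewhere — then `c″(u₁) = φ(c(u₁))` and `φ(c_i) = φ(c(u₁))·c″_i` on the nose),
back to `c′` by `pts_/alphaS_/betaS_rescale`, the colon `(J^φ : (ε x_j)^d) = (J^φ : x_j^d)` by `colon_singleton_unit_mul`, then
`colon_map_span_singleton_chart`, `step_F_eq_monomial_mul_residual … j hbj` at the newborn letter and cleaning-blindness VERBATIM as in IV.
`weakTransform_laws_of_lose_translated` is the cleaning-free core (laws for the weak transform `H₀`); **`betaS_step_le_of_lose_translated_of_child`**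
is the lane's cut (a′) (res-dim4-p-11 g4, 06:10Z): `δs < 2·d!` replaced by the CHILD's `pts′ ≠ ∅`, `αs′ < d!` (cleaning-blindness run
from the child, `H₀ = ε⁻¹G′ − ε⁻¹R`), with the corollary `deltaS_lt_of_lose_translated_of_child : δs < 2·d!`.

[cite: CossartJannsenSaito2020, Lemma 12.1 (3), Lemma 13.6] [cite: CossartPiltant2008, Lemma 4.5 (2)] [cite: Hauser2010, §§F–G]
bears_on: LADDER-RESOLUTION:D157-DOOR2 (res-dim4-pi · K2(p) · slice C (5,3) · Φ-line (R3b)).  Supports stmt-ResolutionOfSingularities-16155 (helper).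
-/

set_option linter.dupNamespace false

noncomputable section

namespace Summit.ResolutionOfSingularities.ResolutionOfSingularities.Theorems.PIDim4

namespace PhiLine

open MvPolynomial Finset IsLocalRing
open Literature.AlgebraicGeometry.Resolution
open Literature.AlgebraicGeometry.Resolution.Hauser2010
open Literature.AlgebraicGeometry.Resolution.WeightedOrder

variable {K : Type} [Field K]

/-- `(x_h + b_h)(0) = b_h`. [folklore] -/
theorem constantCoeff_X_add_C (h : Fin 4) (t : K) : constantCoeff (X h + C t : MvPolynomial (Fin 4) K) = t := by
  rw [map_add, constantCoeff_X, constantCoeff_C, zero_add]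

/-- **THE WEAK TRANSFORM OF A LOSE-h STEP READ IN A CHART `j ≠ h` (core of the translated law, no cleaning, no `hδ2`).**  For
`ord₀ G ≥ d`, chart `j ≠ h` at a point `b` with `b_j = 0`, `b_h ≠ 0`, a left-invertible linear STEP frame `L` (`u₁ = e_h`, the other
rows through the new point) with non-empty polygon and `d! < δs` for `(G)`, and the left-invertible ARRIVAL frame `L′` (`u₁′ = e_j`,
`j`-th coefficients dropped elsewhere): the weak transform `H₀ = translate b (chartTransform d univ j G)` has, in the arrival frame,
a non-empty polygon, `αs(H₀) + d! = δs(G)` and `βs(H₀) ≤ βs(G)`.  (Abstract `u1`-chart laws on the unit-rescaled frame `E • c′`,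
`E(u₁) = (x_h + b_h)/1`, then `pts_/alphaS_/betaS_rescale` and `colon_singleton_unit_mul`.) [OURS]
[cite: CossartJannsenSaito2020, Lemma 12.1 (3), Lemma 13.6] -/
theorem weakTransform_laws_of_lose_translated {d : ℕ} {G : MvPolynomial (Fin 4) K} (hdG : (d : ℕ∞) ≤ ordZero G)
    {h j : Fin 4} (hjh : j ≠ h) {b : Fin 4 → K} (hbj : b j = 0) (hbh : b h ≠ 0)
    (L L' : Fin (2 + 2) → Fin 4 → K) (M M' : Fin 4 → Fin (2 + 2) → K)
    (hM : ∀ t u, ∑ i, M t i * L i u = if t = u then 1 else 0) (hM' : ∀ t u, ∑ i, M' t i * L' i u = if t = u then 1 else 0)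
    (hLu1 : L (u1 2) = Pi.single h 1)
    (hnear : ∀ i, i ≠ u1 2 → ∑ t, L i t * Function.update b j 1 t = 0)
    (hL'u1 : L' (u1 2) = Pi.single j 1) (hL' : ∀ i, i ≠ u1 2 → L' i = Function.update (L i) j 0)
    (hne : (pts (fun i => algebraMap (MvPolynomial (Fin 4) K) (OriginLocalization K 4) (∑ t, C (L i t) * X t))
      (Ideal.span {algebraMap (MvPolynomial (Fin 4) K) (OriginLocalization K 4) G}) d).Nonempty)
    (hδ : d.factorial < deltaS (fun i => algebraMap (MvPolynomial (Fin 4) K) (OriginLocalization K 4) (∑ t, C (L i t) * X t))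
      (Ideal.span {algebraMap (MvPolynomial (Fin 4) K) (OriginLocalization K 4) G}) d) :
    (pts (fun i => algebraMap (MvPolynomial (Fin 4) K) (OriginLocalization K 4) (∑ t, C (L' i t) * X t))
        (Ideal.span {algebraMap (MvPolynomial (Fin 4) K) (OriginLocalization K 4)
          (PointBlowup.translate b (CentreBlowup.chartTransform d Finset.univ j G))}) d).Nonempty ∧
      alphaS (fun i => algebraMap (MvPolynomial (Fin 4) K) (OriginLocalization K 4) (∑ t, C (L' i t) * X t))
          (Ideal.span {algebraMap (MvPolynomial (Fin 4) K) (OriginLocalization K 4)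
            (PointBlowup.translate b (CentreBlowup.chartTransform d Finset.univ j G))}) d + d.factorial =
        deltaS (fun i => algebraMap (MvPolynomial (Fin 4) K) (OriginLocalization K 4) (∑ t, C (L i t) * X t))
          (Ideal.span {algebraMap (MvPolynomial (Fin 4) K) (OriginLocalization K 4) G}) d ∧
      betaS (fun i => algebraMap (MvPolynomial (Fin 4) K) (OriginLocalization K 4) (∑ t, C (L' i t) * X t))
          (Ideal.span {algebraMap (MvPolynomial (Fin 4) K) (OriginLocalization K 4)
            (PointBlowup.translate b (CentreBlowup.chartTransform d Finset.univ j G))}) d ≤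
        betaS (fun i => algebraMap (MvPolynomial (Fin 4) K) (OriginLocalization K 4) (∑ t, C (L i t) * X t))
          (Ideal.span {algebraMap (MvPolynomial (Fin 4) K) (OriginLocalization K 4) G}) d := by
  set alg := algebraMap (MvPolynomial (Fin 4) K) (OriginLocalization K 4) with halg
  set c : Fin (2 + 2) → OriginLocalization K 4 := fun i => alg (∑ t, C (L i t) * X t) with hc
  set c' : Fin (2 + 2) → OriginLocalization K 4 := fun i => alg (∑ t, C (L' i t) * X t) with hc'
  set J : Ideal (OriginLocalization K 4) := Ideal.span {alg G} with hJ
  set φ := Localization.localRingHom (Literature.AlgebraicGeometry.Resolution.originIdeal K 4)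
      (Literature.AlgebraicGeometry.Resolution.originIdeal K 4)
      (((aeval fun i => (X i + C (b i) : MvPolynomial (Fin 4) K)).comp
        (coordBlowupSubst K (↑(Finset.univ : Finset (Fin 4))) j)).toRingHom)
      (comap_translate_coordBlowupSubst_originIdeal hbj) with hφ
  have hcu1 : c (u1 2) = alg (X h) := by simp only [hc, hLu1, sum_C_single_mul_X]
  have hc'u1 : c' (u1 2) = alg (X j) := by simp only [hc', hL'u1, sum_C_single_mul_X]
  -- the unit `(x_h + b_h)/1` and the rescaled arrival frame
  have hεK : constantCoeff (X h + C (b h) : MvPolynomial (Fin 4) K) ≠ 0 := by rwa [constantCoeff_X_add_C]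
  obtain ⟨εu, hεu⟩ := isUnit_algebraMap_of_constantCoeff_ne_zero hεK
  set E : Fin (2 + 2) → (OriginLocalization K 4)ˣ := fun i => if i = u1 2 then εu else εu⁻¹ with hE
  have hEu1 : E (u1 2) = εu := by rw [hE]; exact if_pos rfl
  have hEi : ∀ i, i ≠ u1 2 → E i = εu⁻¹ := fun i hi => by rw [hE]; exact if_neg hi
  have hφu1 : φ (c (u1 2)) = (εu : OriginLocalization K 4) * alg (X j) := by
    rw [hcu1, hφ, halg, localRingHom_chart_algebraMap hbj, translate_coordBlowupSubst_X_of_ne hjh.symm hbj, map_mul, hεu]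
  have hpiv : (fun i => (E i : OriginLocalization K 4) * c' i) (u1 2) = φ (c (u1 2)) := by
    simp only []
    rw [hEu1, hc'u1, hφu1]
  have hoth : ∀ i, i ≠ u1 2 → φ (c i) = φ (c (u1 2)) * (fun i => (E i : OriginLocalization K 4) * c' i) i := by
    intro i hi
    simp only []
    rw [hφu1, hEi i hi]
    change Localization.localRingHom _ _ _ _ (alg (∑ t, C (L i t) * X t)) = _
    rw [halg, localRingHom_chart_linearForm hbj (L i) (hnear i hi), ← hL' i hi, mul_mul_mul_comm, Units.mul_inv, one_mul]
  have hgen : Ideal.span (Set.range c) = maximalIdeal _ := span_range_linearFrame_eq_maximalIdeal L M hM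
  have hgen' : Ideal.span (Set.range c') = maximalIdeal _ := span_range_linearFrame_eq_maximalIdeal L' M' hM'
  have hgen'' : Ideal.span (Set.range fun i => (E i : OriginLocalization K 4) * c' i) = maximalIdeal _ := by
    rw [span_range_rescale, hgen']
  have hdim := ringKrullDim_originLocalization_two_add_two (K := K)
  have hJμ : J ≤ maximalIdeal _ ^ d := span_singleton_algebraMap_le_maximalIdeal_pow hdG
  -- the abstract LOSE law (`u₁`-chart) in the rescaled frame, read back in the linear frame
  have hne' := pts_colon_nonempty φ hpiv hoth hgen hdim hgen'' hdim hJμ hne hδ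
  have hαlaw := alphaS_colon_add φ hpiv hoth hgen hdim hgen'' hdim hJμ hne hδ
  have hβlaw := betaS_colon_le φ hpiv hoth hgen hdim hgen'' hdim hJμ hne hδ
  rw [pts_rescale] at hne'
  rw [alphaS_rescale] at hαlaw
  rw [betaS_rescale] at hβlaw
  -- the weak transform: units do not matter in the colon
  have hcolon : (J.map φ).colon {φ (c (u1 2)) ^ d} =
      Ideal.span {alg (PointBlowup.translate b (CentreBlowup.chartTransform d Finset.univ j G))} := by
    rw [hφu1, mul_pow, colon_singleton_unit_mul ((εu.isUnit).pow d), hJ, halg]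
    exact colon_map_span_singleton_chart hbj G hdG
  rw [hcolon] at hne' hαlaw hβlaw
  exact ⟨hne', hαlaw, hβlaw⟩

/-- **LOSE-h ONE-STEP LAW, TRANSLATED VARIANT (chart `j ≠ h`, `b_h ≠ 0`).**  Let `s.F = x^r · G` with `ord₀ G = d`, `p ≤ |r| + d`,
chart letter `j ≠ h`, new point `b` with `b_j = 0` and `b_h ≠ 0` (the critical letter `h = u₁` is translated away).  Let `L` be a linear
STEP frame with row `u₁ = e_h`, the other rows passing through the new point (`Σ_t L_{i t} (b + e_j)_t = 0` for `i ≠ u₁`), left-invertible,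
with non-empty polygon and `1 < δ < 2` for `(G)`; let `L′` be the ARRIVAL frame (`j`-th coefficients dropped off the pivot row,
`u₁′ = e_j` = the NEWBORN critical letter), left-invertible.  If the new exponent `r′_j = |r| + d − p` satisfies `p ∤ r′_j`, `r′_j + d ≤ p`,
and the next state `(step p univ j b s).F = x^{r′} · G′` has `ord₀ G′ ≥ d`, then in the arrival frame `(G′)` has a non-empty polygon,
**`αs′ + d! = δs`** and **`βs′ ≤ βs`**. [OURS] [cite: CossartJannsenSaito2020, Lemma 12.1 (3), Lemma 13.6] [cite: CossartPiltant2008, Lemma 4.5 (2)] -/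
theorem betaS_step_le_of_lose_translated {p d : ℕ} [DecidableEq K] {s : State K} {r : Fin 4 →₀ ℕ} {G : MvPolynomial (Fin 4) K}
    (hF : s.F = monomial r 1 * G) (hd : ordZero G = d) (hp : p ≤ r.degree + d)
    {h j : Fin 4} (hjh : j ≠ h) {b : Fin 4 → K} (hbj : b j = 0) (hbh : b h ≠ 0)
    (hndvd : ¬ p ∣ (r.degree + d - p)) (hcrit' : r.degree + d - p + d ≤ p)
    (L L' : Fin (2 + 2) → Fin 4 → K) (M M' : Fin 4 → Fin (2 + 2) → K)
    (hM : ∀ t u, ∑ i, M t i * L i u = if t = u then 1 else 0) (hM' : ∀ t u, ∑ i, M' t i * L' i u = if t = u then 1 else 0)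
    (hLu1 : L (u1 2) = Pi.single h 1)
    (hnear : ∀ i, i ≠ u1 2 → ∑ t, L i t * Function.update b j 1 t = 0)
    (hL'u1 : L' (u1 2) = Pi.single j 1) (hL' : ∀ i, i ≠ u1 2 → L' i = Function.update (L i) j 0)
    (hne : (pts (fun i => algebraMap (MvPolynomial (Fin 4) K) (OriginLocalization K 4) (∑ t, C (L i t) * X t))
      (Ideal.span {algebraMap (MvPolynomial (Fin 4) K) (OriginLocalization K 4) G}) d).Nonempty)
    (hδ : d.factorial < deltaS (fun i => algebraMap (MvPolynomial (Fin 4) K) (OriginLocalization K 4) (∑ t, C (L i t) * X t))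
      (Ideal.span {algebraMap (MvPolynomial (Fin 4) K) (OriginLocalization K 4) G}) d)
    (hδ2 : deltaS (fun i => algebraMap (MvPolynomial (Fin 4) K) (OriginLocalization K 4) (∑ t, C (L i t) * X t))
      (Ideal.span {algebraMap (MvPolynomial (Fin 4) K) (OriginLocalization K 4) G}) d < 2 * d.factorial)
    {G' : MvPolynomial (Fin 4) K}
    (hF' : (CentreBlowup.step p Finset.univ j b s).F = monomial ((r.filter fun i => b i = 0).update j (r.degree + d - p)) 1 * G')
    (hd' : (d : ℕ∞) ≤ ordZero G') :
    (pts (fun i => algebraMap (MvPolynomial (Fin 4) K) (OriginLocalization K 4) (∑ t, C (L' i t) * X t))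
        (Ideal.span {algebraMap (MvPolynomial (Fin 4) K) (OriginLocalization K 4) G'}) d).Nonempty ∧
      alphaS (fun i => algebraMap (MvPolynomial (Fin 4) K) (OriginLocalization K 4) (∑ t, C (L' i t) * X t))
          (Ideal.span {algebraMap (MvPolynomial (Fin 4) K) (OriginLocalization K 4) G'}) d + d.factorial =
        deltaS (fun i => algebraMap (MvPolynomial (Fin 4) K) (OriginLocalization K 4) (∑ t, C (L i t) * X t))
          (Ideal.span {algebraMap (MvPolynomial (Fin 4) K) (OriginLocalization K 4) G}) d ∧
      betaS (fun i => algebraMap (MvPolynomial (Fin 4) K) (OriginLocalization K 4) (∑ t, C (L' i t) * X t))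
          (Ideal.span {algebraMap (MvPolynomial (Fin 4) K) (OriginLocalization K 4) G'}) d ≤
        betaS (fun i => algebraMap (MvPolynomial (Fin 4) K) (OriginLocalization K 4) (∑ t, C (L i t) * X t))
          (Ideal.span {algebraMap (MvPolynomial (Fin 4) K) (OriginLocalization K 4) G}) d := by
  have hdG : (d : ℕ∞) ≤ ordZero G := hd.symm.le
  obtain ⟨hne', hαlaw, hβlaw⟩ := weakTransform_laws_of_lose_translated hdG hjh hbj hbh L L' M M' hM hM' hLu1 hnear hL'u1 hL' hne hδ
  set alg := algebraMap (MvPolynomial (Fin 4) K) (OriginLocalization K 4) with halg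
  set c' : Fin (2 + 2) → OriginLocalization K 4 := fun i => alg (∑ t, C (L' i t) * X t) with hc'
  have hc'u1 : c' (u1 2) = alg (X j) := by simp only [hc', hL'u1, sum_C_single_mul_X]
  have hgen' : Ideal.span (Set.range c') = maximalIdeal _ := span_range_linearFrame_eq_maximalIdeal L' M' hM'
  have hdim := ringKrullDim_originLocalization_two_add_two (K := K)
  -- the next residual
  obtain ⟨R, hstep, hRmem⟩ := step_F_eq_monomial_mul_residual (p := p) hF hdG hp j hbj
  rw [hF', monomial_one_mul_cancel_left_iff] at hstep
  have hr'j : ((r.filter fun i => b i = 0).update j (r.degree + d - p)) j = r.degree + d - p := by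
    rw [Finsupp.coe_update, Function.update_self]
  have hR : R ∈ Ideal.span {(X j : MvPolynomial (Fin 4) K) ^ (p - (r.degree + d - p))} := by
    have := hRmem j (by rw [hr'j]; exact hndvd)
    rwa [hr'j] at this
  have hRd : R ∈ Ideal.span {(X j : MvPolynomial (Fin 4) K) ^ d} := by
    obtain ⟨q, rfl⟩ := Ideal.mem_span_singleton'.mp hR
    obtain ⟨k, hk⟩ := Nat.exists_eq_add_of_le (show d ≤ p - (r.degree + d - p) by omega)
    rw [hk, Ideal.mem_span_singleton]
    exact Dvd.dvd.mul_left (pow_dvd_pow (X j) (Nat.le_add_right d k)) _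
  have hε := constantCoeff_prod_ne_zero b (fun i => r i)
  have hH₀ : (d : ℕ∞) ≤ ordZero (PointBlowup.translate b (CentreBlowup.chartTransform d Finset.univ j G)) :=
    le_ordZero_of_eq_unit_mul_add hstep hd' hε hRd
  have hα' : alphaS c' (Ideal.span {alg (PointBlowup.translate b (CentreBlowup.chartTransform d Finset.univ j G))}) d < d.factorial := by
    omega
  have hclean := pts_nonempty_and_alphaS_betaS_eq_of_cleaning c' hgen' hdim (isUnit_algebraMap_of_constantCoeff_ne_zero hε)
    (span_singleton_algebraMap_le_maximalIdeal_pow hH₀) hne' hα'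
    (ρ := alg R) (by rw [hc'u1]; exact algebraMap_mem_span_pow_of_mem_span_pow le_rfl hRd)
  have hG' : Ideal.span {alg G'} = Ideal.span {alg (∏ i ∈ Finset.univ.filter (fun i => b i ≠ 0), (X i + C (b i)) ^ r i) *
      alg (PointBlowup.translate b (CentreBlowup.chartTransform d Finset.univ j G)) + alg R} := by
    rw [hstep, map_add, map_mul]
  rw [hG']
  refine ⟨hclean.1, ?_, hclean.2.2.trans_le hβlaw⟩
  rw [hclean.2.1]; exact hαlaw

/-- **LOSE-h LAW, TRANSLATED VARIANT, CUT FROM THE CHILD SIDE** (the lane's ruling (a′), res-dim4-p-11 g4 2026-08-29 06:10Z, mirrored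
for the chart `j ≠ h`): the hypothesis `δs < 2·d!` of `betaS_step_le_of_lose_translated` is replaced by the CHILD's data in the arrival
frame — non-empty polygon and `αs′ < d!` (which (K-Φ1) `alphaS_lt_of_isIsolated` delivers from the isolation of the child) — because
cleaning-blindness runs symmetrically (`H₀ = ε⁻¹G′ − ε⁻¹R`).  Conclusion: `αs′ + d! = δs` and `βs′ ≤ βs`; in particular `δs < 2·d!`.
[OURS] [cite: CossartJannsenSaito2020, Lemma 12.1 (3), Lemma 13.6] [cite: CossartPiltant2008, Lemma 4.5 (2)] -/
theorem betaS_step_le_of_lose_translated_of_child {p d : ℕ} [DecidableEq K] {s : State K} {r : Fin 4 →₀ ℕ}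
    {G : MvPolynomial (Fin 4) K} (hF : s.F = monomial r 1 * G) (hd : ordZero G = d) (hp : p ≤ r.degree + d)
    {h j : Fin 4} (hjh : j ≠ h) {b : Fin 4 → K} (hbj : b j = 0) (hbh : b h ≠ 0)
    (hndvd : ¬ p ∣ (r.degree + d - p)) (hcrit' : r.degree + d - p + d ≤ p)
    (L L' : Fin (2 + 2) → Fin 4 → K) (M M' : Fin 4 → Fin (2 + 2) → K)
    (hM : ∀ t u, ∑ i, M t i * L i u = if t = u then 1 else 0) (hM' : ∀ t u, ∑ i, M' t i * L' i u = if t = u then 1 else 0)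
    (hLu1 : L (u1 2) = Pi.single h 1)
    (hnear : ∀ i, i ≠ u1 2 → ∑ t, L i t * Function.update b j 1 t = 0)
    (hL'u1 : L' (u1 2) = Pi.single j 1) (hL' : ∀ i, i ≠ u1 2 → L' i = Function.update (L i) j 0)
    (hne : (pts (fun i => algebraMap (MvPolynomial (Fin 4) K) (OriginLocalization K 4) (∑ t, C (L i t) * X t))
      (Ideal.span {algebraMap (MvPolynomial (Fin 4) K) (OriginLocalization K 4) G}) d).Nonempty)
    (hδ : d.factorial < deltaS (fun i => algebraMap (MvPolynomial (Fin 4) K) (OriginLocalization K 4) (∑ t, C (L i t) * X t))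
      (Ideal.span {algebraMap (MvPolynomial (Fin 4) K) (OriginLocalization K 4) G}) d)
    {G' : MvPolynomial (Fin 4) K}
    (hF' : (CentreBlowup.step p Finset.univ j b s).F = monomial ((r.filter fun i => b i = 0).update j (r.degree + d - p)) 1 * G')
    (hd' : (d : ℕ∞) ≤ ordZero G')
    (hne' : (pts (fun i => algebraMap (MvPolynomial (Fin 4) K) (OriginLocalization K 4) (∑ t, C (L' i t) * X t))
      (Ideal.span {algebraMap (MvPolynomial (Fin 4) K) (OriginLocalization K 4) G'}) d).Nonempty)
    (hα' : alphaS (fun i => algebraMap (MvPolynomial (Fin 4) K) (OriginLocalization K 4) (∑ t, C (L' i t) * X t))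
      (Ideal.span {algebraMap (MvPolynomial (Fin 4) K) (OriginLocalization K 4) G'}) d < d.factorial) :
    alphaS (fun i => algebraMap (MvPolynomial (Fin 4) K) (OriginLocalization K 4) (∑ t, C (L' i t) * X t))
          (Ideal.span {algebraMap (MvPolynomial (Fin 4) K) (OriginLocalization K 4) G'}) d + d.factorial =
        deltaS (fun i => algebraMap (MvPolynomial (Fin 4) K) (OriginLocalization K 4) (∑ t, C (L i t) * X t))
          (Ideal.span {algebraMap (MvPolynomial (Fin 4) K) (OriginLocalization K 4) G}) d ∧
      betaS (fun i => algebraMap (MvPolynomial (Fin 4) K) (OriginLocalization K 4) (∑ t, C (L' i t) * X t))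
          (Ideal.span {algebraMap (MvPolynomial (Fin 4) K) (OriginLocalization K 4) G'}) d ≤
        betaS (fun i => algebraMap (MvPolynomial (Fin 4) K) (OriginLocalization K 4) (∑ t, C (L i t) * X t))
          (Ideal.span {algebraMap (MvPolynomial (Fin 4) K) (OriginLocalization K 4) G}) d := by
  have hdG : (d : ℕ∞) ≤ ordZero G := hd.symm.le
  obtain ⟨-, hαlaw, hβlaw⟩ := weakTransform_laws_of_lose_translated hdG hjh hbj hbh L L' M M' hM hM' hLu1 hnear hL'u1 hL' hne hδ
  set alg := algebraMap (MvPolynomial (Fin 4) K) (OriginLocalization K 4) with halg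
  set c' : Fin (2 + 2) → OriginLocalization K 4 := fun i => alg (∑ t, C (L' i t) * X t) with hc'
  have hc'u1 : c' (u1 2) = alg (X j) := by simp only [hc', hL'u1, sum_C_single_mul_X]
  have hgen' : Ideal.span (Set.range c') = maximalIdeal _ := span_range_linearFrame_eq_maximalIdeal L' M' hM'
  have hdim := ringKrullDim_originLocalization_two_add_two (K := K)
  -- the next residual `G′ = ε₀ H₀ + R`, `R ∈ (x_j^d)`
  obtain ⟨R, hstep, hRmem⟩ := step_F_eq_monomial_mul_residual (p := p) hF hdG hp j hbj
  rw [hF', monomial_one_mul_cancel_left_iff] at hstep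
  have hr'j : ((r.filter fun i => b i = 0).update j (r.degree + d - p)) j = r.degree + d - p := by
    rw [Finsupp.coe_update, Function.update_self]
  have hR : R ∈ Ideal.span {(X j : MvPolynomial (Fin 4) K) ^ (p - (r.degree + d - p))} := by
    have := hRmem j (by rw [hr'j]; exact hndvd)
    rwa [hr'j] at this
  have hRd : R ∈ Ideal.span {(X j : MvPolynomial (Fin 4) K) ^ d} := by
    obtain ⟨q, rfl⟩ := Ideal.mem_span_singleton'.mp hR
    obtain ⟨k, hk⟩ := Nat.exists_eq_add_of_le (show d ≤ p - (r.degree + d - p) by omega)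
    rw [hk, Ideal.mem_span_singleton]
    exact Dvd.dvd.mul_left (pow_dvd_pow (X j) (Nat.le_add_right d k)) _
  have hε := constantCoeff_prod_ne_zero b (fun i => r i)
  obtain ⟨u, hu⟩ := isUnit_algebraMap_of_constantCoeff_ne_zero hε
  -- cleaning-blindness from the CHILD side: `H₀ = ε₀⁻¹ G′ − ε₀⁻¹ R`
  have hH₀ : alg (PointBlowup.translate b (CentreBlowup.chartTransform d Finset.univ j G)) =
      ((u⁻¹ : (OriginLocalization K 4)ˣ) : OriginLocalization K 4) * alg G' +
        -(((u⁻¹ : (OriginLocalization K 4)ˣ) : OriginLocalization K 4) * alg R) := by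
    have hu' : alg (∏ i ∈ Finset.univ.filter (fun i => b i ≠ 0), (X i + C (b i)) ^ r i) = (u : OriginLocalization K 4) := by
      rw [halg]; exact hu.symm
    rw [hstep, map_add, map_mul, hu', mul_add, Units.inv_mul_cancel_left, add_neg_cancel_right]
  have hclean := pts_nonempty_and_alphaS_betaS_eq_of_cleaning c' hgen' hdim (Units.isUnit u⁻¹)
    (span_singleton_algebraMap_le_maximalIdeal_pow hd') hne' hα'
    (ρ := -(((u⁻¹ : (OriginLocalization K 4)ˣ) : OriginLocalization K 4) * alg R))
    (by rw [hc'u1]; exact (Ideal.neg_mem_iff _).mpr (Ideal.mul_mem_left _ _ (algebraMap_mem_span_pow_of_mem_span_pow le_rfl hRd)))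
  rw [← hH₀] at hclean
  refine ⟨?_, ?_⟩
  · rw [← hclean.2.1]; exact hαlaw
  · rw [← hclean.2.2]; exact hβlaw

/-- **Corollary: `δs < 2·d!` at a translated LOSE-h step whose child is in band** (non-empty polygon, `αs′ < d!` in the arrival
frame) — the contrapositive of «`δs ≥ 2·d!` ⇒ `αs′ ≥ d!` ⇒ the child is not isolated». [OURS] [cite: CossartJannsenSaito2020, Lemma 12.1 (3)] -/
theorem deltaS_lt_of_lose_translated_of_child {p d : ℕ} [DecidableEq K] {s : State K} {r : Fin 4 →₀ ℕ}
    {G : MvPolynomial (Fin 4) K} (hF : s.F = monomial r 1 * G) (hd : ordZero G = d) (hp : p ≤ r.degree + d)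
    {h j : Fin 4} (hjh : j ≠ h) {b : Fin 4 → K} (hbj : b j = 0) (hbh : b h ≠ 0)
    (hndvd : ¬ p ∣ (r.degree + d - p)) (hcrit' : r.degree + d - p + d ≤ p)
    (L L' : Fin (2 + 2) → Fin 4 → K) (M M' : Fin 4 → Fin (2 + 2) → K)
    (hM : ∀ t u, ∑ i, M t i * L i u = if t = u then 1 else 0) (hM' : ∀ t u, ∑ i, M' t i * L' i u = if t = u then 1 else 0)
    (hLu1 : L (u1 2) = Pi.single h 1)
    (hnear : ∀ i, i ≠ u1 2 → ∑ t, L i t * Function.update b j 1 t = 0)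
    (hL'u1 : L' (u1 2) = Pi.single j 1) (hL' : ∀ i, i ≠ u1 2 → L' i = Function.update (L i) j 0)
    (hne : (pts (fun i => algebraMap (MvPolynomial (Fin 4) K) (OriginLocalization K 4) (∑ t, C (L i t) * X t))
      (Ideal.span {algebraMap (MvPolynomial (Fin 4) K) (OriginLocalization K 4) G}) d).Nonempty)
    (hδ : d.factorial < deltaS (fun i => algebraMap (MvPolynomial (Fin 4) K) (OriginLocalization K 4) (∑ t, C (L i t) * X t))
      (Ideal.span {algebraMap (MvPolynomial (Fin 4) K) (OriginLocalization K 4) G}) d)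
    {G' : MvPolynomial (Fin 4) K}
    (hF' : (CentreBlowup.step p Finset.univ j b s).F = monomial ((r.filter fun i => b i = 0).update j (r.degree + d - p)) 1 * G')
    (hd' : (d : ℕ∞) ≤ ordZero G')
    (hne' : (pts (fun i => algebraMap (MvPolynomial (Fin 4) K) (OriginLocalization K 4) (∑ t, C (L' i t) * X t))
      (Ideal.span {algebraMap (MvPolynomial (Fin 4) K) (OriginLocalization K 4) G'}) d).Nonempty)
    (hα' : alphaS (fun i => algebraMap (MvPolynomial (Fin 4) K) (OriginLocalization K 4) (∑ t, C (L' i t) * X t))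
      (Ideal.span {algebraMap (MvPolynomial (Fin 4) K) (OriginLocalization K 4) G'}) d < d.factorial) :
    deltaS (fun i => algebraMap (MvPolynomial (Fin 4) K) (OriginLocalization K 4) (∑ t, C (L i t) * X t))
      (Ideal.span {algebraMap (MvPolynomial (Fin 4) K) (OriginLocalization K 4) G}) d < 2 * d.factorial := by
  have h := (betaS_step_le_of_lose_translated_of_child hF hd hp hjh hbj hbh hndvd hcrit' L L' M M' hM hM' hLu1 hnear hL'u1 hL'
    hne hδ hF' hd' hne' hα').1
  omega

end PhiLine

end Summit.ResolutionOfSingularities.ResolutionOfSingularities.Theorems.PIDim4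

end
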